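import Mathlib
import Summits.Ventures.PercRepro2.Defs
import Summits.Ventures.PercRepro2.Independence
import Summits.Ventures.PercRepro2.Harris
import Summits.Ventures.PercRepro2.Graph
import Summits.Ventures.PercRepro2.Exploration
import Summits.Ventures.PercRepro2.Events
import Summits.Ventures.PercRepro2.FourFunctions
import Summits.Ventures.PercRepro2.Induced
import Summits.Ventures.PercRepro2.Frontier
import Summits.Ventures.PercRepro2.ObsIndependence
import Summits.Ventures.PercRepro2.BHK
import Summits.Ventures.PercRepro2.BHKEvents
import Summits.Ventures.PercRepro2.OrderPreservation
import Summits.Ventures.PercRepro2.BHKAvoid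
import Summits.Ventures.PercRepro2.SameClusterAvoid
import Summits.Ventures.PercRepro2.CaseOneRegime
import Summits.Ventures.PercRepro2.CaseOnePos
import Summits.Ventures.PercRepro2.CaseOneJ11
import Summits.Ventures.PercRepro2.CaseOneRV
import Summits.Ventures.PercRepro2.CaseOnePendant
import Summits.Ventures.PercRepro2.CaseOnePendantAny
import Summits.Ventures.PercRepro2.HCov
import Summits.Ventures.PercRepro2.HCovSwap
import Summits.Ventures.PercRepro2.OddsLemma
import Summits.Ventures.PercRepro2.RV
import Summits.Ventures.PercRepro2.RVBridge

/-!
# The case-1 rung in the two-world `D = Q ∩ {a₃ ∉ C₂}`: the D-world `(ii)` as a Prop, and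
`(ii)_D ⟹ (ii)` (blind cell PercRepro2, p1 g14; S5 §2.1 (K9), proofs/P1-DWORLD.md §1)

Mine-a's two-world form (DOM-D) conditions on `D := Q ∩ {a₃ ∉ C₂}` instead of `Q`. For the
`(ii)`-side of the Z-split this gives the **D-world `(ii)`** at a general threshold pair `(c₀, c₁)`:

  `iiExprD c₀ c₁ := P(D) · E[1_{b∈C₂} · Z · 1_D] − E[1_{b∈C₂} 1_D] · E[Z 1_D]`,  `Z = 1[a₃ ∈ C₁](c₁ 1[o ∈ C₂] − c₀)`

(`P(D)² · Cov_{P(·|D)}(1[b ∈ C₂], Z)`), and **`ZSplitIID`** := `0 ≤ iiExprD D_o D` at the PD pair.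
Because `Z` is supported on `{a₃ ∈ C₁} ⊆ D`, the Q-world and the D-world covariances are tied by the
exact identity (**`Dw_mul_iiExprT_eq`**)

  `P(D) · iiExprT c₀ c₁ = P(Q) · iiExprD c₀ c₁ + (c₁ P(T′, o ∈ C₂) − c₀ P(T′)) · (P(Q, a₃ ∈ C₂) P(D, b ∈ C₂) − P(D) P(Q, a₃ ∈ C₂, b ∈ C₂))`

whose last factor is `≤ 0` by BHK 1.3 (`{b ∈ C₂}`, `{a₃ ∈ C₂}` under `Q`) and whose middle factor is
`≤ 0` whenever `c₀/c₁ ≥ P(o ∈ C₂ | T′)` — in particular at the PD pair (the odds lemma `odds_b`) and at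
the Q pair. Hence **`iiExprT_nonneg_of_dworld`**: `(ii-t)_D ⟹ (ii-t)` for every `t ≥ P(o ∈ C₂ ∣ T′)`, and
**`zSplitII_of_dworld`**: `ZSplitIID ⟹ ZSplitII`. The two base cases of the degree-2 reduction
(P1-DWORLD.md §3) are here too: `a₃ = o` (`iiExprD_nonneg_of_a3_eq_o`, BHK 1.4 with the avoided set
`{a₁, o}`) and `a₃ = b` (`iiExprD_nonneg_of_a3_eq_b`, the odds condition alone).

CAUTION (census, own code iid_kit_single.py, kit j232118: n = 6, 5 ≤ m ≤ 10, 437,556 instances): the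
D-world `(ii)` at the PD threshold `γ` is FALSE on 2 instances (extreme weights `{1,127}/128`, where
`γ ≪ γ_Q`), while at the Q threshold `γ_Q = P(o ∈ U ∣ Q)` it has 0 failures — so `ZSplitIID` is a
SUFFICIENT condition for `(ii)`, not a strengthening that holds everywhere; nothing about `ZSplitIID`
itself is claimed here. Own code; standard axioms.
-/

namespace Summit.Ventures.PercRepro2

namespace CaseOne

/-! ## The D-world and the D-world `(ii)` -/

section Defs
variable {V : Type*} {E : Type*} [Fintype E] [DecidableEq E] {R : Type*} [CommRing R]

/-- **The D-world** `D = Q ∩ {a₃ ∉ C₂}` (mine-a's (DOM-D) world). -/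
def Dw (ends : E → Sym2 V) (a₁ a₂ a₃ : V) : Set (Config E) :=
  (connEvent ends a₁ a₂)ᶜ ∩ (connEvent ends a₂ a₃)ᶜ

/-- **The D-world `(ii)` at a general threshold pair**, cleared by `P(D)²`:
`P(D) E[1_{b∈C₂} Z 1_D] − E[1_{b∈C₂} 1_D] E[Z 1_D]`, `Z = zFunT c₀ c₁`. -/
noncomputable def iiExprD (p : E → R) (ends : E → Sym2 V) (o a₁ a₂ a₃ b : V) (c₀ c₁ : R) : R :=
  prob p (Dw ends a₁ a₂ a₃) *
      expect p (fun ω => (connEvent ends a₂ b).indicator 1 ω * zFunT ends o a₁ a₂ a₃ c₀ c₁ ω *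
        (Dw ends a₁ a₂ a₃).indicator 1 ω) -
    expect p (fun ω => (connEvent ends a₂ b).indicator 1 ω * (Dw ends a₁ a₂ a₃).indicator 1 ω) *
      expect p (fun ω => zFunT ends o a₁ a₂ a₃ c₀ c₁ ω * (Dw ends a₁ a₂ a₃).indicator 1 ω)

omit [Fintype E] [DecidableEq E] in
/-- On `Q`, `a₃ ∈ C₁` forces `a₃ ∉ C₂`. -/
lemma not_conn_a2_a3_of_A {ends : E → Sym2 V} {ω : Config E} {a₁ a₂ a₃ : V}
    (hA : Conn ends ω a₁ a₃) (hQ : ¬ Conn ends ω a₁ a₂) : ¬ Conn ends ω a₂ a₃ :=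
  fun h => hQ (conn_trans hA (conn_symm h))

omit [Fintype E] [DecidableEq E] in
/-- `{a₃ ∈ C₁} ∩ D = {a₃ ∈ C₁} ∩ Q`. -/
lemma A_inter_Dw (ends : E → Sym2 V) (a₁ a₂ a₃ : V) :
    connEvent ends a₁ a₃ ∩ Dw ends a₁ a₂ a₃ = connEvent ends a₁ a₃ ∩ (connEvent ends a₁ a₂)ᶜ := by
  ext ω
  simp only [Dw, Set.mem_inter_iff, Set.mem_compl_iff, mem_connEvent]
  exact ⟨fun h => ⟨h.1, h.2.1⟩, fun h => ⟨h.1, h.2, not_conn_a2_a3_of_A h.1 h.2⟩⟩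

omit [Fintype E] [DecidableEq E] in
/-- `{b ∈ C₂} ∩ {a₃ ∈ C₁} ∩ {o ∈ C₂} ∩ D = … ∩ Q`. -/
lemma BAO_inter_Dw (ends : E → Sym2 V) (o a₁ a₂ a₃ b : V) :
    connEvent ends a₂ b ∩ connEvent ends a₁ a₃ ∩ connEvent ends a₂ o ∩ Dw ends a₁ a₂ a₃ =
      connEvent ends a₂ b ∩ connEvent ends a₁ a₃ ∩ connEvent ends a₂ o ∩ (connEvent ends a₁ a₂)ᶜ := by
  ext ω
  simp only [Dw, Set.mem_inter_iff, Set.mem_compl_iff, mem_connEvent]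
  exact ⟨fun h => ⟨h.1, h.2.1⟩, fun h => ⟨h.1, h.2, not_conn_a2_a3_of_A h.1.1.2 h.2⟩⟩

omit [Fintype E] [DecidableEq E] in
/-- `{a₃ ∈ C₁} ∩ {o ∈ C₂} ∩ D = … ∩ Q`. -/
lemma AO_inter_Dw (ends : E → Sym2 V) (o a₁ a₂ a₃ : V) :
    connEvent ends a₁ a₃ ∩ connEvent ends a₂ o ∩ Dw ends a₁ a₂ a₃ =
      connEvent ends a₁ a₃ ∩ connEvent ends a₂ o ∩ (connEvent ends a₁ a₂)ᶜ := by
  ext ω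
  simp only [Dw, Set.mem_inter_iff, Set.mem_compl_iff, mem_connEvent]
  exact ⟨fun h => ⟨h.1, h.2.1⟩, fun h => ⟨h.1, h.2, not_conn_a2_a3_of_A h.1.1 h.2⟩⟩

omit [Fintype E] [DecidableEq E] in
/-- `{b ∈ C₂} ∩ {a₃ ∈ C₁} ∩ D = … ∩ Q`. -/
lemma BA_inter_Dw (ends : E → Sym2 V) (a₁ a₂ a₃ b : V) :
    connEvent ends a₂ b ∩ connEvent ends a₁ a₃ ∩ Dw ends a₁ a₂ a₃ =
      connEvent ends a₂ b ∩ connEvent ends a₁ a₃ ∩ (connEvent ends a₁ a₂)ᶜ := by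
  ext ω
  simp only [Dw, Set.mem_inter_iff, Set.mem_compl_iff, mem_connEvent]
  exact ⟨fun h => ⟨h.1, h.2.1⟩, fun h => ⟨h.1, h.2, not_conn_a2_a3_of_A h.1.2 h.2⟩⟩

/-- **`iiExprD` in event probabilities**: `c₁ · A_D − c₀ · B_D` with
`A_D = P(D) P(Q, b ∈ C₂, a₃ ∈ C₁, o ∈ C₂) − P(D, b ∈ C₂) P(Q, a₃ ∈ C₁, o ∈ C₂)` and
`B_D = P(D) P(Q, b ∈ C₂, a₃ ∈ C₁) − P(D, b ∈ C₂) P(Q, a₃ ∈ C₁)` (the `A`-events lie inside `D`). -/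
theorem iiExprD_eq (p : E → R) (ends : E → Sym2 V) (o a₁ a₂ a₃ b : V) (c₀ c₁ : R) :
    iiExprD p ends o a₁ a₂ a₃ b c₀ c₁ =
      c₁ * (prob p (Dw ends a₁ a₂ a₃) *
          prob p (connEvent ends a₂ b ∩ connEvent ends a₁ a₃ ∩ connEvent ends a₂ o ∩
            (connEvent ends a₁ a₂)ᶜ) -
        prob p (connEvent ends a₂ b ∩ Dw ends a₁ a₂ a₃) *
          prob p (connEvent ends a₁ a₃ ∩ connEvent ends a₂ o ∩ (connEvent ends a₁ a₂)ᶜ)) -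
      c₀ * (prob p (Dw ends a₁ a₂ a₃) *
          prob p (connEvent ends a₂ b ∩ connEvent ends a₁ a₃ ∩ (connEvent ends a₁ a₂)ᶜ) -
        prob p (connEvent ends a₂ b ∩ Dw ends a₁ a₂ a₃) *
          prob p (connEvent ends a₁ a₃ ∩ (connEvent ends a₁ a₂)ᶜ)) := by
  unfold iiExprD zFunT
  have e1 : expect p (fun ω => (connEvent ends a₂ b).indicator (1 : Config E → R) ω *
      ((connEvent ends a₁ a₃).indicator 1 ω *
        (c₁ * (connEvent ends a₂ o).indicator 1 ω - c₀)) *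
      (Dw ends a₁ a₂ a₃).indicator 1 ω) =
      expect p (fun ω => ((connEvent ends a₂ b).indicator (1 : Config E → R) ω *
        (connEvent ends a₁ a₃).indicator 1 ω) *
        (c₁ * (connEvent ends a₂ o).indicator 1 ω - c₀) *
        (Dw ends a₁ a₂ a₃).indicator 1 ω) := by
    congr 1
    funext ω
    ring
  rw [e1, expect_mul_affine, expect_mul_affine]
  simp only [expect_ind4, expect_ind3, expect_ind2]
  rw [BAO_inter_Dw, AO_inter_Dw, BA_inter_Dw, A_inter_Dw]
  ring

end Defs

section Prop'
variable {V : Type*} {E : Type*} [Fintype E] [DecidableEq E] {R : Type*} [CommRing R] [LinearOrder R]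

/-- **The D-world `(ii)` at the PD pair**: `0 ≤ iiExprD D_o D`. A definition only (a SUFFICIENT
condition for `(ii)`; census: false on 2 / 437,556 instances at n = 6 — see the module docstring). -/
def ZSplitIID (p : E → R) (ends : E → Sym2 V) (o a₁ a₂ a₃ b : V) : Prop :=
  0 ≤ iiExprD p ends o a₁ a₂ a₃ b (Dpdo p ends o a₁ a₂ a₃) (Dpd p ends a₁ a₂ a₃)

end Prop'

/-! ## `(ii)_D ⟹ (ii)`: the one-line lemma -/

section OneLine
variable {V : Type*} {E : Type*} [Fintype E] [DecidableEq E] {R : Type*} [CommRing R]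

/-- `P(Q) = P(D) + P(Q, a₃ ∈ C₂)`. -/
lemma probQ_eq_Dw_add (p : E → R) (ends : E → Sym2 V) (a₁ a₂ a₃ : V) :
    prob p (connEvent ends a₁ a₂)ᶜ =
      prob p (Dw ends a₁ a₂ a₃) + prob p (connEvent ends a₂ a₃ ∩ (connEvent ends a₁ a₂)ᶜ) := by
  have h := prob_inter_add_prob_inter_compl p (connEvent ends a₁ a₂)ᶜ (connEvent ends a₂ a₃)
  rw [Set.inter_comm] at h
  unfold Dw
  linear_combination -h

/-- `P(Q, b ∈ C₂) = P(D, b ∈ C₂) + P(Q, a₃ ∈ C₂, b ∈ C₂)`. -/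
lemma probQB_eq_DwB_add (p : E → R) (ends : E → Sym2 V) (a₁ a₂ a₃ b : V) :
    prob p (connEvent ends a₂ b ∩ (connEvent ends a₁ a₂)ᶜ) =
      prob p (connEvent ends a₂ b ∩ Dw ends a₁ a₂ a₃) +
        prob p (connEvent ends a₂ b ∩ connEvent ends a₂ a₃ ∩ (connEvent ends a₁ a₂)ᶜ) := by
  have h := prob_inter_add_prob_inter_compl p (connEvent ends a₂ b ∩ (connEvent ends a₁ a₂)ᶜ)
    (connEvent ends a₂ a₃)
  have e1 : connEvent ends a₂ b ∩ (connEvent ends a₁ a₂)ᶜ ∩ (connEvent ends a₂ a₃)ᶜ =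
      connEvent ends a₂ b ∩ Dw ends a₁ a₂ a₃ := by
    unfold Dw; rw [Set.inter_assoc]
  have e2 : connEvent ends a₂ b ∩ (connEvent ends a₁ a₂)ᶜ ∩ connEvent ends a₂ a₃ =
      connEvent ends a₂ b ∩ connEvent ends a₂ a₃ ∩ (connEvent ends a₁ a₂)ᶜ := by
    ext ω; simp only [Set.mem_inter_iff]; tauto
  rw [e1, e2] at h
  linear_combination -h

/-- **The Q-world and the D-world `(ii)` are tied by an exact identity**:
`P(D) · iiExprT c₀ c₁ = P(Q) · iiExprD c₀ c₁ + (c₁ P(T′, o ∈ C₂) − c₀ P(T′)) · (P(Q, a₃ ∈ C₂) P(D, b ∈ C₂) − P(D) P(Q, a₃ ∈ C₂, b ∈ C₂))`. -/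
theorem Dw_mul_iiExprT_eq (p : E → R) (ends : E → Sym2 V) (o a₁ a₂ a₃ b : V) (c₀ c₁ : R) :
    prob p (Dw ends a₁ a₂ a₃) * iiExprT p ends o a₁ a₂ a₃ b c₀ c₁ =
      prob p (connEvent ends a₁ a₂)ᶜ * iiExprD p ends o a₁ a₂ a₃ b c₀ c₁ +
        (c₁ * prob p (connEvent ends a₁ a₃ ∩ connEvent ends a₂ o ∩ (connEvent ends a₁ a₂)ᶜ) -
          c₀ * prob p (connEvent ends a₁ a₃ ∩ (connEvent ends a₁ a₂)ᶜ)) *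
        (prob p (connEvent ends a₂ a₃ ∩ (connEvent ends a₁ a₂)ᶜ) *
            prob p (connEvent ends a₂ b ∩ Dw ends a₁ a₂ a₃) -
          prob p (Dw ends a₁ a₂ a₃) *
            prob p (connEvent ends a₂ b ∩ connEvent ends a₂ a₃ ∩ (connEvent ends a₁ a₂)ᶜ)) := by
  rw [iiExprT_eq, iiExprD_eq, probQ_eq_Dw_add p ends a₁ a₂ a₃, probQB_eq_DwB_add p ends a₁ a₂ a₃ b]
  ring

end OneLine

section OneLineOrder
variable {V : Type*} {E : Type*} [Fintype E] [DecidableEq E] [Fintype V] [DecidableEq V]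
  {R : Type*} [CommRing R] [LinearOrder R] [IsStrictOrderedRing R]

/-- BHK 1.3 under `Q` for the same-cluster events `{b ∈ C₂}`, `{a₃ ∈ C₂}`:
`P(Q, b ∈ C₂) · P(Q, a₃ ∈ C₂) ≤ P(Q, b ∈ C₂, a₃ ∈ C₂) · P(Q)`. -/
lemma bhk_same_b_a3 (p : E → R) (hp : IsProbVec p) (ends : E → Sym2 V) (a₁ a₂ a₃ b : V) :
    prob p (connEvent ends a₂ b ∩ (connEvent ends a₁ a₂)ᶜ) *
        prob p (connEvent ends a₂ a₃ ∩ (connEvent ends a₁ a₂)ᶜ) ≤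
      prob p (connEvent ends a₂ b ∩ connEvent ends a₂ a₃ ∩ (connEvent ends a₁ a₂)ᶜ) *
        prob p (connEvent ends a₁ a₂)ᶜ := by
  have h := bhk_same_cluster_events p hp ends a₂ a₁ (isUpperSet_mem_setOf b) (isUpperSet_mem_setOf a₃)
  rw [← connEvent_eq_clusterInEvent ends a₂ b, ← connEvent_eq_clusterInEvent ends a₂ a₃,
    connEvent_comm ends a₂ a₁] at h
  exact h

omit [Fintype V] [DecidableEq V] in
/-- The A-masses vanish when the D-world has mass zero. -/
lemma prob_A_eq_zero_of_Dw (p : E → R) (hp : IsProbVec p) (ends : E → Sym2 V) (a₁ a₂ a₃ : V)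
    (hd : prob p (Dw ends a₁ a₂ a₃) = 0) {X : Set (Config E)}
    (hX : X ⊆ connEvent ends a₁ a₃ ∩ (connEvent ends a₁ a₂)ᶜ) : prob p X = 0 := by
  have hsub : X ⊆ Dw ends a₁ a₂ a₃ := by
    intro ω hω
    have h := hX hω
    rw [← A_inter_Dw] at h
    exact h.2
  exact le_antisymm (hd ▸ prob_mono hp hsub) (prob_nonneg hp X)

/-- **`(ii-t)_D ⟹ (ii-t)`** for every threshold pair with `c₁ · P(T′, o ∈ C₂) ≤ c₀ · P(T′)`
(i.e. `t = c₀/c₁ ≥ P(o ∈ C₂ ∣ T′)`): the one-line lemma. -/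
theorem iiExprT_nonneg_of_dworld (p : E → R) (hp : IsProbVec p) (ends : E → Sym2 V)
    (o a₁ a₂ a₃ b : V) (c₀ c₁ : R)
    (hD : 0 ≤ iiExprD p ends o a₁ a₂ a₃ b c₀ c₁)
    (hodds : c₁ * prob p (connEvent ends a₁ a₃ ∩ connEvent ends a₂ o ∩ (connEvent ends a₁ a₂)ᶜ) ≤
      c₀ * prob p (connEvent ends a₁ a₃ ∩ (connEvent ends a₁ a₂)ᶜ)) :
    0 ≤ iiExprT p ends o a₁ a₂ a₃ b c₀ c₁ := by
  have hkey := Dw_mul_iiExprT_eq p ends o a₁ a₂ a₃ b c₀ c₁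
  -- the last factor is `≤ 0` (BHK 1.3)
  have hbhk := bhk_same_b_a3 p hp ends a₁ a₂ a₃ b
  have hq := probQ_eq_Dw_add p ends a₁ a₂ a₃
  have hqB := probQB_eq_DwB_add p ends a₁ a₂ a₃ b
  have hlast : prob p (connEvent ends a₂ a₃ ∩ (connEvent ends a₁ a₂)ᶜ) *
      prob p (connEvent ends a₂ b ∩ Dw ends a₁ a₂ a₃) -
      prob p (Dw ends a₁ a₂ a₃) *
        prob p (connEvent ends a₂ b ∩ connEvent ends a₂ a₃ ∩ (connEvent ends a₁ a₂)ᶜ) ≤ 0 := by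
    rw [hq, hqB] at hbhk
    nlinarith [hbhk]
  have hmid : c₁ * prob p (connEvent ends a₁ a₃ ∩ connEvent ends a₂ o ∩ (connEvent ends a₁ a₂)ᶜ) -
      c₀ * prob p (connEvent ends a₁ a₃ ∩ (connEvent ends a₁ a₂)ᶜ) ≤ 0 := by linarith
  have hprod : 0 ≤ (c₁ * prob p (connEvent ends a₁ a₃ ∩ connEvent ends a₂ o ∩
      (connEvent ends a₁ a₂)ᶜ) - c₀ * prob p (connEvent ends a₁ a₃ ∩ (connEvent ends a₁ a₂)ᶜ)) *
      (prob p (connEvent ends a₂ a₃ ∩ (connEvent ends a₁ a₂)ᶜ) *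
          prob p (connEvent ends a₂ b ∩ Dw ends a₁ a₂ a₃) -
        prob p (Dw ends a₁ a₂ a₃) *
          prob p (connEvent ends a₂ b ∩ connEvent ends a₂ a₃ ∩ (connEvent ends a₁ a₂)ᶜ)) :=
    mul_nonneg_of_nonpos_of_nonpos hmid hlast
  have hQ0 : 0 ≤ prob p (connEvent ends a₁ a₂)ᶜ := prob_nonneg hp _
  have hmul : 0 ≤ prob p (Dw ends a₁ a₂ a₃) * iiExprT p ends o a₁ a₂ a₃ b c₀ c₁ := by
    rw [hkey]
    exact add_nonneg (mul_nonneg hQ0 hD) hprod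
  rcases (prob_nonneg hp (Dw ends a₁ a₂ a₃)).lt_or_eq with hd | hd
  · exact nonneg_of_mul_nonneg_right (by linarith [hmul]) hd
  · -- the D-world has mass zero: so has `{a₃ ∈ C₁} ∩ Q`, and `iiExprT = 0`
    rw [iiExprT_eq]
    have h1 := prob_A_eq_zero_of_Dw p hp ends a₁ a₂ a₃ hd.symm (X := connEvent ends a₂ b ∩
      connEvent ends a₁ a₃ ∩ connEvent ends a₂ o ∩ (connEvent ends a₁ a₂)ᶜ)
      (fun ω h => ⟨h.1.1.2, h.2⟩)
    have h2 := prob_A_eq_zero_of_Dw p hp ends a₁ a₂ a₃ hd.symm (X := connEvent ends a₁ a₃ ∩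
      connEvent ends a₂ o ∩ (connEvent ends a₁ a₂)ᶜ) (fun ω h => ⟨h.1.1, h.2⟩)
    have h3 := prob_A_eq_zero_of_Dw p hp ends a₁ a₂ a₃ hd.symm (X := connEvent ends a₂ b ∩
      connEvent ends a₁ a₃ ∩ (connEvent ends a₁ a₂)ᶜ) (fun ω h => ⟨h.1.2, h.2⟩)
    have h4 := prob_A_eq_zero_of_Dw p hp ends a₁ a₂ a₃ hd.symm (X := connEvent ends a₁ a₃ ∩
      (connEvent ends a₁ a₂)ᶜ) (fun ω h => h)
    rw [h1, h2, h3, h4]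
    simp

end OneLineOrder

/-! ## `ZSplitIID ⟹ ZSplitII` (the odds lemma supplies the threshold condition at the PD pair) -/

section PD
variable {V : Type*} {E : Type*} [Fintype E] [DecidableEq E] [Fintype V] [DecidableEq V]
  {R : Type*} [Field R] [LinearOrder R] [IsStrictOrderedRing R]

/-- **The odds lemma in the `CaseOne` vocabulary**: `D · P(T′, o ∈ C₂) ≤ D_o · P(T′)`, i.e.
`γ ≥ P(o ∈ C₂ ∣ a₃ ∈ C₁, Q)` (mine-a's `odds_b`). -/
theorem odds_pd (p : E → R) (hp : IsProbVec p) (ends : E → Sym2 V) (o a₁ a₂ a₃ : V) :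
    Dpd p ends a₁ a₂ a₃ *
        prob p (connEvent ends a₁ a₃ ∩ connEvent ends a₂ o ∩ (connEvent ends a₁ a₂)ᶜ) ≤
      Dpdo p ends o a₁ a₂ a₃ * prob p (connEvent ends a₁ a₃ ∩ (connEvent ends a₁ a₂)ᶜ) := by
  have h := CovForm.odds_b p hp ends o a₁ a₂ a₃
  rw [← J1RV.Dpd_eq, ← J1RV.Dpdo_eq] at h
  have e1 : TEvent ends a₂ a₁ a₃ ∩ connEvent ends a₂ o =
      connEvent ends a₁ a₃ ∩ connEvent ends a₂ o ∩ (connEvent ends a₁ a₂)ᶜ := by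
    unfold TEvent; ext ω; simp only [Set.mem_inter_iff, Set.mem_compl_iff]; tauto
  have e2 : TEvent ends a₂ a₁ a₃ = connEvent ends a₁ a₃ ∩ (connEvent ends a₁ a₂)ᶜ := by
    unfold TEvent; ext ω; simp only [Set.mem_inter_iff, Set.mem_compl_iff]; tauto
  rw [e1, e2] at h
  linarith [h]

/-- **`ZSplitIID ⟹ ZSplitII`**: the D-world `(ii)` at the PD pair implies `(ii)`. -/
theorem zSplitII_of_dworld (p : E → R) (hp : IsProbVec p) (ends : E → Sym2 V) (o a₁ a₂ a₃ b : V)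
    (h : ZSplitIID p ends o a₁ a₂ a₃ b) : ZSplitII p ends o a₁ a₂ a₃ b := by
  unfold ZSplitIID at h
  unfold ZSplitII
  rw [iiExpr_eq_iiExprT]
  exact iiExprT_nonneg_of_dworld p hp ends o a₁ a₂ a₃ b _ _ h (odds_pd p hp ends o a₁ a₂ a₃)

end PD

/-! ## The two marked base cases: `a₃ = o` and `a₃ = b` -/

section Base
variable {V : Type*} {E : Type*} [Fintype E] [DecidableEq E] [Fintype V] [DecidableEq V]
  {R : Type*} [CommRing R] [LinearOrder R] [IsStrictOrderedRing R]

omit [Fintype E] [DecidableEq E] [Fintype V] in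
/-- `D` with `a₃ = o` is `{a₂ ↮ a₁, a₂ ↮ o}`. -/
lemma Dw_eq_avoidAll (ends : E → Sym2 V) (a₁ a₂ x : V) :
    Dw ends a₁ a₂ x = avoidAll ends a₂ {a₁, x} := by
  ext ω
  simp only [Dw, Set.mem_inter_iff, Set.mem_compl_iff, mem_connEvent, mem_avoidAll,
    Finset.mem_insert, Finset.mem_singleton, forall_eq_or_imp, forall_eq]
  exact ⟨fun h => ⟨fun hc => h.1 (conn_symm hc), h.2⟩, fun h => ⟨fun hc => h.1 (conn_symm hc), h.2⟩⟩

/-- **Base case `a₃ = o`**: `0 ≤ iiExprD` for every pair with `0 ≤ c₀` — BHK 1.4 with the avoided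
set `{a₁, o}` (the `o ∈ C₂` masses vanish). -/
theorem iiExprD_nonneg_of_a3_eq_o (p : E → R) (hp : IsProbVec p) (ends : E → Sym2 V)
    (o a₁ a₂ b : V) (c₀ c₁ : R) (hc₀ : 0 ≤ c₀) : 0 ≤ iiExprD p ends o a₁ a₂ o b c₀ c₁ := by
  rw [iiExprD_eq]
  have hz : ∀ X : Set (Config E), X ⊆ connEvent ends a₁ o ∩ connEvent ends a₂ o ∩
      (connEvent ends a₁ a₂)ᶜ → prob p X = 0 := by
    intro X hX
    have : X = ∅ := by
      ext ω
      simp only [Set.mem_empty_iff_false, iff_false]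
      intro hω
      obtain ⟨⟨h1, h2⟩, h3⟩ := hX hω
      exact h3 (conn_trans h1 (conn_symm h2))
    rw [this, prob_empty]
  rw [hz (connEvent ends a₂ b ∩ connEvent ends a₁ o ∩ connEvent ends a₂ o ∩
      (connEvent ends a₁ a₂)ᶜ) (fun ω h => ⟨⟨h.1.1.2, h.1.2⟩, h.2⟩),
    hz (connEvent ends a₁ o ∩ connEvent ends a₂ o ∩ (connEvent ends a₁ a₂)ᶜ) (fun ω h => h)]
  -- BHK 1.4 with avoidance of `{a₁, o}` for `{b ∈ C₂}` and `{o ∈ C₁}`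
  have h := bhk_cross_cluster_avoid p hp ends a₂ a₁ (X := {a₁, o}) (by simp)
    (isUpperSet_mem_setOf b) (isUpperSet_mem_setOf o)
  rw [← connEvent_eq_clusterInEvent ends a₂ b, ← connEvent_eq_clusterInEvent ends a₁ o,
    ← Dw_eq_avoidAll] at h
  have e1 : connEvent ends a₂ b ∩ connEvent ends a₁ o ∩ Dw ends a₁ a₂ o =
      connEvent ends a₂ b ∩ connEvent ends a₁ o ∩ (connEvent ends a₁ a₂)ᶜ :=
    BA_inter_Dw ends a₁ a₂ o b
  have e2 : connEvent ends a₁ o ∩ Dw ends a₁ a₂ o =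
      connEvent ends a₁ o ∩ (connEvent ends a₁ a₂)ᶜ := A_inter_Dw ends a₁ a₂ o
  rw [e1, e2] at h
  nlinarith [h, hc₀]

omit [Fintype V] [DecidableEq V] in
/-- **Base case `a₃ = b`**: `0 ≤ iiExprD` whenever `c₁ · P(Q, b ∈ C₁, o ∈ C₂) ≤ c₀ · P(Q, b ∈ C₁)`
(the `b ∈ C₁ ∩ C₂` masses vanish). -/
theorem iiExprD_nonneg_of_a3_eq_b (p : E → R) (hp : IsProbVec p) (ends : E → Sym2 V)
    (o a₁ a₂ b : V) (c₀ c₁ : R)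
    (hodds : c₁ * prob p (connEvent ends a₁ b ∩ connEvent ends a₂ o ∩ (connEvent ends a₁ a₂)ᶜ) ≤
      c₀ * prob p (connEvent ends a₁ b ∩ (connEvent ends a₁ a₂)ᶜ)) :
    0 ≤ iiExprD p ends o a₁ a₂ b b c₀ c₁ := by
  rw [iiExprD_eq]
  have hz : ∀ X : Set (Config E), X ⊆ connEvent ends a₂ b ∩ connEvent ends a₁ b ∩
      (connEvent ends a₁ a₂)ᶜ → prob p X = 0 := by
    intro X hX
    have : X = ∅ := by
      ext ω
      simp only [Set.mem_empty_iff_false, iff_false]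
      intro hω
      obtain ⟨⟨h1, h2⟩, h3⟩ := hX hω
      exact h3 (conn_trans h2 (conn_symm h1))
    rw [this, prob_empty]
  rw [hz (connEvent ends a₂ b ∩ connEvent ends a₁ b ∩ connEvent ends a₂ o ∩
      (connEvent ends a₁ a₂)ᶜ) (fun ω h => ⟨h.1.1, h.2⟩),
    hz (connEvent ends a₂ b ∩ connEvent ends a₁ b ∩ (connEvent ends a₁ a₂)ᶜ) (fun ω h => h)]
  have hB := prob_nonneg hp (connEvent ends a₂ b ∩ Dw ends a₁ a₂ b)
  nlinarith [hodds, hB]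

end Base

end CaseOne

end Summit.Ventures.PercRepro2
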